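import Literature.Analysis.FluidPDE.FluidComputer.TaylorGreenCurvature
import Summits.NavierStokesRegularity.FunctionalMining.NoGo.GalerkinReduction
import HarnessLib

/-!
# The Taylor–Green enstrophy curvature for every amplitude: `Z̈_S(0) = (5/64)A⁴ + (27/2)ν²A²`, i.e. Ohkitani's `Q_ξ(0) = (5/18)·Q(0)²` in the inviscid case

HONEST FRAMING (cell `pub-fluidc`, verbatim): *low prior, high value-of-information experiment on Tao's
machine paradigm; NOT a claim that NS blows up.* Nothing here concerns the Navier–Stokes PDE beyond the
Galerkin-truncated ODE system both engines of the cell integrate.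

Taylor & Green (1937) expand the flow from the datum `A·(cos ax sin ay sin az, -sin ax cos ay sin az, 0)`
in the variable `T = Aat` [cite: TaylorGreen1937, eq. (47) p. 511]; Ohkitani (2001) keeps the amplitude `A`
as a free parameter of the same datum and prints the inviscid enstrophy as a series in `ξ = t²`,
`Q = (3/8)A² + (5/128)A⁴ξ + (25/4224)A⁶ξ²/2! − …`, whence the amplitude-free identity
`Q_ξ(0) = (5/18)·Q(0)²` on which his ODE reduction rests [cite: Ohkitani2001ODEEnstrophy, eq. (24), (30)].
The tree's `TaylorGreenCurvature` proves the `A = 1` statement for the truncated system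
(`Z̈_S(0) = 5/64 + (27/2)ν²`). THIS FILE proves it for EVERY real amplitude `A` (the datum
`scale A tg`): along any unforced Galerkin solution on a mode set containing the eight Taylor–Green modes
and the eight first-excited modes,

  **`Z̈_S(0) = (5/64)·A⁴ + (27/2)·ν²·A²`**, `Z_S(0) = (3/8)·A²`
  (`hasDerivAt_deriv_truncEnstrophy_tg_amplitude`),

so that in the truncated-Euler case **`Z̈_S(0) = (5/9)·Z_S(0)²`** for every amplitude
(`deriv2_truncEnstrophy_tg_euler_amplitude`; `Z̈ = 2Q_ξ`, `2·(5/18) = 5/9` — Ohkitani's (30), first line),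
and in general `Z̈_S(0) = (5/9)Z_S(0)² + 36ν²Z_S(0)` (`…_ohkitani_form`). The ingredients are the
amplitude-scaling laws of the quadratic functionals, `modalEnergy_scale`, `truncEnergy_scale`,
`truncEnstrophy_scale` (`∝ A²`, reused from `FunctionalMining.Galerkin`), and the new `leray_scale_advection`, `curvatureQ_scale`
(`Q_S(A·û) = A⁴·Q_S(û)`: the advection term is quadratic, the curvature functional quadratic in it),
`isSingleShell_scale`. 0 sorry, 0 named facts (D-0026).
-/

noncomputable section

namespace Summit.NavierStokesRegularity.FluidComputer.TaylorGreenAmplitude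

open Literature.Analysis.FluidPDE.FluidComputer
open Literature.Analysis.FluidPDE.FluidComputer.ShellTransfer
open Literature.Analysis.FluidPDE.FluidComputer.ShellTransfer.TaylorGreenHat
open Summit.NavierStokesRegularity.FunctionalMining.Galerkin (modalEnergy_scale truncEnergy_scale truncEnstrophy_scale)
open Complex

/-! ## Amplitude scaling of the quadratic functionals -/

/-! The amplitude-scaling laws `modalEnergy_scale`, `truncEnergy_scale`, `truncEnstrophy_scale` (`∝ A²`)
are already in the tree (`Summit.NavierStokesRegularity.FunctionalMining.Galerkin`, filed by the functional-mining
cell) and are reused from there. -/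

/-- The Leray-projected advection term is quadratic in the amplitude:
`P_k N_S[A·û](k) = A²·P_k N_S[û](k)`. [folklore] -/
theorem leray_scale_advection (r : ℝ) (V : FourierVelocity) (S : Finset (Fin 3 → ℤ))
    (k : Fin 3 → ℤ) (j : Fin 3) :
    leray k (advection (scale r V) S k) j = (r : ℂ) ^ 2 * leray k (advection V S k) j := by
  have e : advection (scale r V) S k = fun i => (r : ℂ) ^ 2 * advection V S k i := by
    funext i
    exact advection_scale r V S k i
  rw [e, GalerkinODE.leray_const_mul]

/-- **`Q_S(A·û) = A⁴·Q_S(û)`**: the enstrophy-curvature functional is quartic in the amplitude. [folklore] -/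
theorem curvatureQ_scale (r : ℝ) (V : FourierVelocity) (S : Finset (Fin 3 → ℤ)) (lam : ℝ) :
    curvatureQ (scale r V) S lam = r ^ 4 * curvatureQ V S lam := by
  unfold curvatureQ
  rw [Finset.mul_sum]
  refine Finset.sum_congr rfl fun k _ => ?_
  have e : ∑ j, Complex.normSq (leray k (advection (scale r V) S k) j)
      = r ^ 4 * ∑ j, Complex.normSq (leray k (advection V S k) j) := by
    rw [Finset.mul_sum]
    refine Finset.sum_congr rfl fun j _ => ?_
    rw [leray_scale_advection, Complex.normSq_mul, map_pow, Complex.normSq_ofReal]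
    ring
  rw [e]
  ring

/-- Scaling preserves the single-shell property. [folklore] -/
theorem isSingleShell_scale (r : ℝ) {V : FourierVelocity} {lam : ℝ} (h : IsSingleShell V lam) :
    IsSingleShell (scale r V) lam := by
  intro k hk
  refine h k ?_
  intro h0
  apply hk
  funext j
  rw [scale_coeff, congrFun h0 j, Pi.zero_apply, mul_zero]

/-! ## The Taylor–Green datum at amplitude `A` -/

/-- `Z_S(A·tg) = (3/8)·A²` on any mode set containing the eight modes
[cite: Ohkitani2001ODEEnstrophy, eq. (24): `Q(0) = (3/8)A²`]. -/
theorem truncEnstrophy_scale_tg {S : Finset (Fin 3 → ℤ)} (hS : modes ⊆ S) (A : ℝ) :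
    truncEnstrophy (scale A tg) S = 3 / 8 * A ^ 2 := by
  rw [truncEnstrophy_scale, truncEnstrophy_tg_of_subset hS]
  ring

/-- `Q_S(A·tg) = (5/64)·A⁴` on any mode set containing the eight modes and the eight first-excited modes.
[folklore] -/
theorem curvatureQ_scale_tg {S : Finset (Fin 3 → ℤ)} (hS : modes ⊆ S) (hR : rateModes ⊆ S) (A : ℝ) :
    curvatureQ (scale A tg) S 3 = 5 / 64 * A ^ 4 := by
  rw [curvatureQ_scale, curvatureQ_tg hS hR]
  ring

/-- **THE TAYLOR–GREEN ENSTROPHY CURVATURE AT EVERY AMPLITUDE.** Along any unforced Galerkin solution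
(any `ν`, any pressure multiplier) supported in a mode set `S ⊇ modes ∪ rateModes` and started from
`A·tg`: `Z̈_S(0) = (5/64)A⁴ + (27/2)ν²A²` — Taylor & Green's `T²` coefficient in the variable `T = Aat`
[cite: TaylorGreen1937, eq. (47) p. 511], inviscid part `(5/128)A⁴·2` as printed by
[cite: Ohkitani2001ODEEnstrophy, eq. (24)]. -/
theorem hasDerivAt_deriv_truncEnstrophy_tg_amplitude {U : ℝ → FourierVelocity} {S : Finset (Fin 3 → ℤ)}
    {ν : ℝ} {c : ℝ → (Fin 3 → ℤ) → ℂ} (hU : IsGalerkinSolution U S ν c fun _ _ _ => 0)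
    (hsupp : IsSupportedOn U S) (A : ℝ) (h0 : U 0 = scale A tg) (hS : modes ⊆ S)
    (hR : rateModes ⊆ S) :
    HasDerivAt (deriv fun s => truncEnstrophy (U s) S) (5 / 64 * A ^ 4 + 27 / 2 * ν ^ 2 * A ^ 2) 0 := by
  have h := hasDerivAt_deriv_truncEnstrophy_singleShell' hU hsupp 0 (lam := 3)
    (by rw [h0]; exact isSingleShell_scale A tg_isSingleShell)
  rw [h0, truncEnstrophy_scale_tg hS, curvatureQ_scale_tg hS hR] at h
  convert h using 1
  ring

/-- **Ohkitani's form** [cite: Ohkitani2001ODEEnstrophy, eq. (30)]: with `Z_S(0) = (3/8)A²`, the same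
statement reads `Z̈_S(0) = (5/9)·Z_S(0)² + 36ν²·Z_S(0)` — amplitude-free. -/
theorem hasDerivAt_deriv_truncEnstrophy_tg_ohkitani_form {U : ℝ → FourierVelocity}
    {S : Finset (Fin 3 → ℤ)} {ν : ℝ} {c : ℝ → (Fin 3 → ℤ) → ℂ}
    (hU : IsGalerkinSolution U S ν c fun _ _ _ => 0) (hsupp : IsSupportedOn U S) (A : ℝ)
    (h0 : U 0 = scale A tg) (hS : modes ⊆ S) (hR : rateModes ⊆ S) :
    HasDerivAt (deriv fun s => truncEnstrophy (U s) S)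
      (5 / 9 * truncEnstrophy (U 0) S ^ 2 + 36 * ν ^ 2 * truncEnstrophy (U 0) S) 0 := by
  have h := hasDerivAt_deriv_truncEnstrophy_tg_amplitude hU hsupp A h0 hS hR
  rw [h0, truncEnstrophy_scale_tg hS]
  convert h using 1
  ring

/-- **Truncated Euler, every amplitude: `Z̈_S(0) = (5/9)·Z_S(0)²`** — Ohkitani's identity
`Q_ξ(0) = (5/18)·Q(0)²` (`ξ = t²`, so `Z̈(0) = 2Q_ξ(0)`) for the system the engines integrate
[cite: Ohkitani2001ODEEnstrophy, eq. (30), first line]. -/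
theorem deriv2_truncEnstrophy_tg_euler_amplitude {U : ℝ → FourierVelocity} {S : Finset (Fin 3 → ℤ)}
    {c : ℝ → (Fin 3 → ℤ) → ℂ} (hU : IsGalerkinSolution U S 0 c fun _ _ _ => 0)
    (hsupp : IsSupportedOn U S) (A : ℝ) (h0 : U 0 = scale A tg) (hS : modes ⊆ S)
    (hR : rateModes ⊆ S) :
    deriv (deriv fun s => truncEnstrophy (U s) S) 0 = 5 / 9 * truncEnstrophy (U 0) S ^ 2 := by
  have h := (hasDerivAt_deriv_truncEnstrophy_tg_ohkitani_form hU hsupp A h0 hS hR).deriv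
  rw [h]
  ring

/-- The explicit inviscid value: `Z̈_S(0) = (5/64)·A⁴` [cite: Ohkitani2001ODEEnstrophy, eq. (24)]. -/
theorem deriv2_truncEnstrophy_tg_euler_amplitude_explicit {U : ℝ → FourierVelocity}
    {S : Finset (Fin 3 → ℤ)} {c : ℝ → (Fin 3 → ℤ) → ℂ}
    (hU : IsGalerkinSolution U S 0 c fun _ _ _ => 0) (hsupp : IsSupportedOn U S) (A : ℝ)
    (h0 : U 0 = scale A tg) (hS : modes ⊆ S) (hR : rateModes ⊆ S) :
    deriv (deriv fun s => truncEnstrophy (U s) S) 0 = 5 / 64 * A ^ 4 := by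
  have h := (hasDerivAt_deriv_truncEnstrophy_tg_amplitude hU hsupp A h0 hS hR).deriv
  rw [h]
  ring

end Summit.NavierStokesRegularity.FluidComputer.TaylorGreenAmplitude

end
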